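import Literature.NumberTheory.IwasawaTheory.ImaginaryQuadraticTwoTowerRootsOfUnity
import Literature.NumberTheory.IwasawaTheory.ImaginaryQuadraticTwoTowerTotallyRamifiedEven
import Literature.NumberTheory.IwasawaTheory.ZpExtensionNormKernelOnePrime
import HarnessLib

/-!
# The dyadic prime along the cyclotomic `ℤ₂`-tower of `ℚ(√−d)`, `d ≡ 1 (mod 4)`: unique in every layer, totally ramified over `2`, ramified over the real
# subfield, with class of order dividing `2` (proved; no definition, no named fact)

Topic `NumberTheory/IwasawaTheory` (namespace = path).  THEOREM-ONLY file, written by the prover seat `bsd-line-att-p3` g32 (cell `bsd-f1-sign2`; `--supports`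
stmt-BirchSwinnertonDyer-22298; closes nothing).  Sequel of `ImaginaryQuadraticTwoTowerTotallyRamifiedEven` (Fukuda index `0`) towards the `2`-RAMIFIED half of
Ferrero's / Kida's `λ₂`-formula (`d ≡ 1, 2 (mod 4)`), where the capitulation kernel of `Cl(K_n) → Cl(K_{n+1})` is generated by the class of the dyadic prime.

* §1 `exists_dyadic_prime_of_sq_eq_neg` — `K ∋ η`, `η² = −d`, `d ≡ 1 (mod 4)`: `K` has exactly ONE prime `v₀ ∋ 2`, and `e(v₀ ∣ 2) = 2` (`(1+η)² = 2(η − 2m)` with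
  `η − 2m ∉ v₀`).
* §2 `exists_dyadic_prime_layer` — for every cyclotomic `ℤ₂`-extension `κK` of `K` and every `m`: the layer `K_m` has exactly one prime `𝔓_m ∋ 2`, with
  `e(𝔓_m ∣ K) = 2^m` and `e(𝔓_m ∣ 2) = 2^{m+1} = [K_m : ℚ]` (Fukuda index `0` + Washington Lemma 13.3, tree `exists_ramificationIdx_eq_pow_of_totallyRamifiedFrom_zero`).
* §3 `dyadic_of_isCMField` — a CM number field `X` with `h(X⁺)` odd, `[X : ℚ] = 2^m·2`, and a unique prime `𝔓 ∋ 2` with `e(𝔓 ∣ 2) = 2^{m+1}`: then `e(𝔓 ∣ 𝔓 ∩ X⁺) = 2`,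
  `𝔓 ∩ X⁺` is the unique prime of `X⁺` above `2`, it is PRINCIPAL... in the class group (`[𝔓 ∩ X⁺] = 1`: order dividing `2^m` and `h(X⁺)`), and `[𝔓]² = 1`.
* §4 `exists_dyadic_prime_fieldRange_sup_layer` — transport to `X_m = e(K)·ℚ_m ⊆ ℚ̄` along the tree's `X_m ≅ (K·ℚ_∞)_m`: unique `𝔓_m ∋ 2`, `e(𝔓_m ∣ 2) = 2^{m+1}`;
  with §3: `e(𝔓_m ∣ X_m⁺) = 2` and `[𝔓_m]² = 1`.

References: [Washington1997] §13.1, Prop. 13.2, Lemma 13.3; [Ferrero1980AJM] §§2–3; [Kida1979Tohoku] Thm. 1; [NeukirchANT1999] Ch. I §8 Prop. (8.2), §9 (9.1);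
[Marcus2018] Ch. 3 Thm. 25 (`2` ramifies in `ℚ(√−d)`, `d ≡ 1 (mod 4)`).
-/

set_option autoImplicit false

noncomputable section

open scoped NumberField nonZeroDivisors
open NumberField NumberField.IsCMField IsDedekindDomain Field IntermediateField Module Ideal UniqueFactorizationMonoid

namespace Literature.NumberTheory.IwasawaTheory

open Literature.NumberTheory.EllipticCurves Literature.NumberTheory.EllipticCurves.ZpExtension
  Literature.NumberTheory.GaloisRepresentations Literature.NumberTheory.NumberFields

/-! ## §1 The dyadic prime of `ℚ(√−d)`, `d ≡ 1 (mod 4)` -/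

section Base

variable (K : Type) [Field K] [NumberField K]

/-- **`K ∋ η`, `η² = −d`, `d ≡ 1 (mod 4)` ⟹ `K` has exactly one prime `v₀` above `2`, with `e(v₀ ∣ 2) = 2`.**  `(1 + η)² = 2(η − 2m)` (`d = 4m+1`) with `η − 2m ∉ w`
for every `w ∋ 2` (else the odd integer `d = −η² ∈ w`), so `e(w ∣ 2) = 2·ord_w(1+η)` is even, `= 2 = [K : ℚ]`, and the fundamental identity leaves one prime.
[cite: Marcus2018, Ch. 3 Thm. 25] [cite: NeukirchANT1999, Ch. I §8 Prop. (8.2)] -/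
theorem exists_dyadic_prime_of_sq_eq_neg (hK2 : Module.finrank ℚ K = 2) {d : ℕ} (hd4 : d % 4 = 1) (hη : ∃ η : K, η ^ 2 = -((d : ℕ) : K)) :
    ∃ v₀ : HeightOneSpectrum (𝓞 K), (2 : 𝓞 K) ∈ v₀.asIdeal ∧ v₀.asIdeal.ramificationIdx ℤ = 2 ∧
      ∀ w : HeightOneSpectrum (𝓞 K), (2 : 𝓞 K) ∈ w.asIdeal → w = v₀ := by
  classical
  obtain ⟨η, hη⟩ := hη
  haveI : (Ideal.span {(2 : ℤ)}).IsMaximal := ((Ideal.span_singleton_prime two_ne_zero).mpr Int.prime_two).isMaximal (by simp)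
  have h20 : Ideal.span {(2 : ℤ)} ≠ ⊥ := by simp
  -- `e(w ∣ 2) = 2` for every `w ∋ 2`
  have hint : IsIntegral ℤ η := by
    refine IsIntegral.of_pow two_pos ?_
    rw [hη]; exact (isIntegral_natCast d).neg
  set ηI : 𝓞 K := ⟨η, hint⟩ with hηI
  set m : ℤ := ((d : ℤ) - 1) / 4 with hm
  have hdm : (d : ℤ) = 4 * m + 1 := by omega
  set u : 𝓞 K := ηI - 2 * (m : 𝓞 K) with hu
  have hsq : (1 + ηI) ^ 2 = 2 * u := by
    apply Subtype.ext
    change (((1 + ηI) ^ 2 : 𝓞 K) : K) = ((2 * u : 𝓞 K) : K)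
    rw [hu]
    push_cast
    change (1 + η) ^ 2 = 2 * (η - 2 * (m : K))
    have hdK : ((d : ℕ) : K) = 4 * (m : K) + 1 := by
      have : ((d : ℤ) : K) = ((4 * m + 1 : ℤ) : K) := by rw [hdm]
      push_cast at this
      exact this
    rw [hdK] at hη
    linear_combination hη
  have he2 : ∀ w : HeightOneSpectrum (𝓞 K), (2 : 𝓞 K) ∈ w.asIdeal → w.asIdeal.ramificationIdx ℤ = 2 := by
    intro w hw
    haveI := w.isPrime
    haveI : w.asIdeal.LiesOver (Ideal.span {(2 : ℤ)}) := by
      rw [Ideal.liesOver_span_iff w.isPrime.ne_top Int.prime_two, map_ofNat]; exact hw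
    -- `u ∉ w`
    have huw : u ∉ w.asIdeal := by
      intro huw
      have hηw : ηI ∈ w.asIdeal := by
        have : ηI = u + (m : 𝓞 K) * 2 := by rw [hu]; ring
        rw [this]; exact w.asIdeal.add_mem huw (w.asIdeal.mul_mem_left _ hw)
      have hdw : ((d : ℕ) : 𝓞 K) ∈ w.asIdeal := by
        have : ((d : ℕ) : 𝓞 K) = -(ηI ^ 2) := by
          apply Subtype.ext; change ((d : ℕ) : K) = -η ^ 2; rw [hη, neg_neg]
        rw [this]; exact w.asIdeal.neg_mem_iff.mpr (w.asIdeal.pow_mem_of_mem hηw 2 two_pos)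
      have hone : (1 : 𝓞 K) ∈ w.asIdeal := by
        have hdZ : ((d : ℕ) : 𝓞 K) = ((4 * m + 1 : ℤ) : 𝓞 K) := by
          have : ((d : ℤ) : 𝓞 K) = ((4 * m + 1 : ℤ) : 𝓞 K) := by rw [hdm]
          exact_mod_cast this
        have : (1 : 𝓞 K) = ((d : ℕ) : 𝓞 K) - (2 * m : 𝓞 K) * 2 := by rw [hdZ]; push_cast; ring
        rw [this]; exact w.asIdeal.sub_mem hdw (w.asIdeal.mul_mem_left _ hw)
      exact w.isPrime.ne_top ((Ideal.eq_top_iff_one _).mpr hone)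
    have hu0 : u ≠ 0 := fun h => huw (by rw [h]; exact w.asIdeal.zero_mem)
    have h1η0 : 1 + ηI ≠ 0 := by
      intro h
      apply hu0
      have := hsq
      rw [h, zero_pow two_ne_zero] at this
      rcases mul_eq_zero.mp this.symm with h2 | h2
      · exact absurd h2 two_ne_zero
      · exact h2
    have hspan : Ideal.span {1 + ηI} ^ 2 = Ideal.span {(2 : 𝓞 K)} * Ideal.span {u} := by
      rw [Ideal.span_singleton_pow, hsq, Ideal.span_singleton_mul_span_singleton]
    have hmap : Ideal.map (algebraMap ℤ (𝓞 K)) (Ideal.span {(2 : ℤ)}) = Ideal.span {(2 : 𝓞 K)} := by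
      rw [Ideal.map_span, Set.image_singleton, map_ofNat]
    have hp0 : Ideal.map (algebraMap ℤ (𝓞 K)) (Ideal.span {(2 : ℤ)}) ≠ ⊥ := Ideal.map_ne_bot_of_ne_bot h20
    have h2ne : (Ideal.span {(2 : 𝓞 K)} : Ideal (𝓞 K)) ≠ ⊥ := by rw [← hmap]; exact hp0
    have hune : (Ideal.span {u} : Ideal (𝓞 K)) ≠ ⊥ := by rw [Ne, Ideal.span_singleton_eq_bot]; exact hu0
    have hcountu : Multiset.count w.asIdeal (normalizedFactors (Ideal.span {u})) = 0 := by
      rw [Multiset.count_eq_zero]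
      intro hmem
      exact huw (Ideal.dvd_span_singleton.mp (dvd_of_mem_normalizedFactors hmem))
    have hcount : Multiset.count w.asIdeal (normalizedFactors (Ideal.span {(2 : 𝓞 K)})) =
        2 * Multiset.count w.asIdeal (normalizedFactors (Ideal.span {1 + ηI})) := by
      have h := congrArg (fun I => Multiset.count w.asIdeal (normalizedFactors I)) hspan
      rw [normalizedFactors_pow, Multiset.count_nsmul, normalizedFactors_mul h2ne hune, Multiset.count_add, hcountu, add_zero] at h
      exact h.symm
    have he : w.asIdeal.ramificationIdx ℤ = 2 * Multiset.count w.asIdeal (normalizedFactors (Ideal.span {1 + ηI})) := by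
      rw [Ideal.IsDedekindDomain.ramificationIdx_eq_normalizedFactors_count (Ideal.span {(2 : ℤ)}) w.asIdeal hp0, hmap, hcount]
    have hle : w.asIdeal.ramificationIdx ℤ ≤ Module.finrank ℚ K := by
      rw [← Ideal.ramificationIdx'_eq_ramificationIdx (Ideal.span {(2 : ℤ)}) w.asIdeal h20]
      exact Ideal.ramificationIdx_le_finrank (𝓞 K) ℚ K w.asIdeal
    have hpos : 0 < w.asIdeal.ramificationIdx ℤ := Ideal.ramificationIdx_pos w.asIdeal ℤ
    rw [hK2] at hle
    omega
  -- a prime above `2`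
  obtain ⟨Q, hQmax, hQover⟩ := Ideal.exists_maximal_ideal_liesOver_of_isIntegral (S := 𝓞 K) (Ideal.span {(2 : ℤ)})
  set v₀ : HeightOneSpectrum (𝓞 K) := ⟨Q, hQmax.isPrime, Ideal.ne_bot_of_liesOver_of_ne_bot h20 Q⟩ with hv₀
  have h2v₀ : (2 : 𝓞 K) ∈ v₀.asIdeal := by
    have h := Ideal.mem_span_singleton_self (2 : ℤ)
    rw [hQover.over, Ideal.under_def, Ideal.mem_comap, map_ofNat] at h
    exact h
  refine ⟨v₀, h2v₀, he2 v₀ h2v₀, fun w hw => ?_⟩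
  -- uniqueness by the fundamental identity for the Galois extension `K/ℚ`
  haveI : Module.Free ℚ K := Module.Free.of_divisionRing ℚ K
  haveI : Algebra.IsQuadraticExtension ℚ K := { finrank_eq_two' := hK2 }
  haveI : IsGalois ℚ K := Algebra.IsQuadraticExtension.isGalois ℚ K
  haveI : IsGaloisGroup (K ≃ₐ[ℚ] K) ℤ (𝓞 K) := IsGaloisGroup.of_isFractionRing (K ≃ₐ[ℚ] K) ℤ (𝓞 K) ℚ K
  haveI := w.isPrime
  haveI hw2 : w.asIdeal.LiesOver (Ideal.span {(2 : ℤ)}) := by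
    rw [Ideal.liesOver_span_iff w.isPrime.ne_top Int.prime_two, map_ofNat]; exact hw
  haveI := hQmax.isPrime
  have hG : Nat.card (K ≃ₐ[ℚ] K) = 2 := by rw [IsGalois.card_aut_eq_finrank, hK2]
  have hefg := Ideal.ncard_primesOver_mul_ramificationIdxIn_mul_inertiaDegIn (Ideal.span {(2 : ℤ)}) (𝓞 K) (K ≃ₐ[ℚ] K)
  rw [hG, Ideal.ramificationIdxIn_eq_ramificationIdx (Ideal.span {(2 : ℤ)}) Q (K ≃ₐ[ℚ] K), he2 v₀ h2v₀] at hefg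
  have hncard : ((Ideal.span {(2 : ℤ)}).primesOver (𝓞 K)).ncard = 1 := by
    have h1 : ((Ideal.span {(2 : ℤ)}).primesOver (𝓞 K)).ncard * (Ideal.span {(2 : ℤ)}).inertiaDegIn (𝓞 K) = 1 := by
      apply Nat.eq_of_mul_eq_mul_right two_pos
      calc ((Ideal.span {(2 : ℤ)}).primesOver (𝓞 K)).ncard * (Ideal.span {(2 : ℤ)}).inertiaDegIn (𝓞 K) * 2
          = ((Ideal.span {(2 : ℤ)}).primesOver (𝓞 K)).ncard * (2 * (Ideal.span {(2 : ℤ)}).inertiaDegIn (𝓞 K)) := by ring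
        _ = 2 := hefg
        _ = 1 * 2 := (one_mul 2).symm
    exact Nat.eq_one_of_mul_eq_one_right h1
  obtain ⟨P, hP⟩ := Set.ncard_eq_one.mp hncard
  have hwmem : w.asIdeal ∈ (Ideal.span {(2 : ℤ)}).primesOver (𝓞 K) := ⟨w.isPrime, hw2⟩
  have hvmem : v₀.asIdeal ∈ (Ideal.span {(2 : ℤ)}).primesOver (𝓞 K) := ⟨hQmax.isPrime, hQover⟩
  rw [hP, Set.mem_singleton_iff] at hwmem hvmem
  exact HeightOneSpectrum.ext (hwmem.trans hvmem.symm)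

/-! ## §2 The dyadic prime of every layer of a cyclotomic `ℤ₂`-extension of `K` -/

/-- **Every layer `K_m` of a cyclotomic `ℤ₂`-extension of `K = ℚ(√−d)`, `d ≡ 1 (mod 4)`, has exactly one prime `𝔓_m ∋ 2`, with `e(𝔓_m ∣ K) = 2^m` and
`e(𝔓_m ∣ 2) = 2^{m+1} = [K_m : ℚ]`** (Fukuda index `0`, tree `totallyRamifiedFrom_zero_of_sq_eq_neg_of_mod_four_eq_one`, and Washington Lemma 13.3 at finite level, tree
`exists_ramificationIdx_eq_pow_of_totallyRamifiedFrom_zero`; `e(𝔓_m ∣ 2) = e(v₀ ∣ 2)·e(𝔓_m ∣ v₀)`). [cite: Washington1997, §13.1 Lemma 13.3 and Prop. 13.2] [cite: Ferrero1980AJM, §2] -/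
theorem exists_dyadic_prime_layer (hK2 : Module.finrank ℚ K = 2) {d : ℕ} (hd4 : d % 4 = 1) (hη : ∃ η : K, η ^ 2 = -((d : ℕ) : K))
    (κK : ZpExtension K 2) (hκK : κK.IsCyclotomic) (m : ℕ) [NumberField (κK.layer m)] :
    ∃ (𝔓 : Ideal (𝓞 (κK.layer m))) (_ : 𝔓.IsMaximal), 𝔓.ramificationIdx (𝓞 K) = 2 ^ m ∧ 𝔓.ramificationIdx ℤ = 2 ^ (m + 1) ∧
      (2 : 𝓞 (κK.layer m)) ∈ 𝔓 ∧ ∀ (Q : Ideal (𝓞 (κK.layer m))) [Q.IsMaximal], (2 : 𝓞 (κK.layer m)) ∈ Q → Q = 𝔓 := by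
  haveI : Fact (Nat.Prime 2) := ⟨Nat.prime_two⟩
  have hTR := totallyRamifiedFrom_zero_of_sq_eq_neg_of_mod_four_eq_one K hK2 hd4 hη κK hκK
  obtain ⟨v₀, h2v₀, hev₀, huniq⟩ := exists_dyadic_prime_of_sq_eq_neg K hK2 hd4 hη
  have huniq' : ∀ w : HeightOneSpectrum (𝓞 K), ((2 : ℕ) : 𝓞 K) ∈ w.asIdeal → w = v₀ := fun w hw => huniq w (by exact_mod_cast hw)
  obtain ⟨𝔓, h𝔓max, he, huniq𝔓⟩ := exists_ramificationIdx_eq_pow_of_totallyRamifiedFrom_zero κK m hTR v₀ huniq'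
  haveI := h𝔓max
  -- membership of `2`
  have hmem_iff : ∀ (Q : Ideal (𝓞 (κK.layer m))), (2 : 𝓞 (κK.layer m)) ∈ Q ↔ ((2 : ℕ) : 𝓞 K) ∈ Q.under (𝓞 K) := fun Q => by
    rw [Ideal.under_def, Ideal.mem_comap, Nat.cast_ofNat, map_ofNat]
  haveI : v₀.asIdeal.IsMaximal := v₀.isMaximal
  obtain ⟨Q₀, hQ₀max, hQ₀over⟩ := Ideal.exists_maximal_ideal_liesOver_of_isIntegral (S := 𝓞 (κK.layer m)) v₀.asIdeal
  haveI := hQ₀max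
  have h2Q₀ : (2 : 𝓞 (κK.layer m)) ∈ Q₀ := by
    rw [hmem_iff, ← hQ₀over.over]; exact_mod_cast h2v₀
  have hQ₀ : Q₀ = 𝔓 := huniq𝔓 Q₀ ((hmem_iff Q₀).mp h2Q₀)
  have h2𝔓 : (2 : 𝓞 (κK.layer m)) ∈ 𝔓 := hQ₀ ▸ h2Q₀
  -- `𝔓` lies over `v₀` and over `(2)`
  haveI h𝔓v₀ : 𝔓.LiesOver v₀.asIdeal := by rw [← hQ₀]; exact hQ₀over
  haveI hv₀2 : v₀.asIdeal.LiesOver (Ideal.span {(2 : ℤ)}) := by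
    rw [Ideal.liesOver_span_iff v₀.isPrime.ne_top Int.prime_two, map_ofNat]; exact h2v₀
  haveI := v₀.isPrime
  have htower : 𝔓.ramificationIdx ℤ = v₀.asIdeal.ramificationIdx ℤ * 𝔓.ramificationIdx (𝓞 K) :=
    Ideal.ramificationIdx_tower (R := ℤ) (S := 𝓞 K) (T := 𝓞 (κK.layer m)) (q := v₀.asIdeal) (r := 𝔓)
  refine ⟨𝔓, h𝔓max, he, ?_, h2𝔓, fun Q _ hQ => huniq𝔓 Q ((hmem_iff Q).mp hQ)⟩
  rw [htower, hev₀, he, pow_succ, mul_comm]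

end Base

/-! ## §3 A CM field with a unique, totally ramified dyadic prime -/

section CM

variable (X : Type) [Field X] [NumberField X] [IsCMField X]

/-- **The dyadic prime of a CM field with a unique prime above `2` of ramification index `[X : ℚ]`.**  `X` CM with `h(X⁺)` odd and `[X : ℚ] = 2^m·2`; `𝔓` the only prime of
`X` containing `2`, `e(𝔓 ∣ 2) = 2^{m+1}`.  THEN: `e(𝔓 ∣ 𝔓 ∩ X⁺) = 2` (`e(𝔓 ∩ X⁺ ∣ 2) ≤ [X⁺ : ℚ] = 2^m`, `e ≤ 2` in `X/X⁺`), and `[𝔓]² = 1` in `Cl(X)`: `𝔓² = (𝔓 ∩ X⁺)𝓞_X`,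
and `𝔓 ∩ X⁺` — the only prime of `X⁺` above `2`, `(2) = (𝔓 ∩ X⁺)^{2^m}` — has a class of order dividing `2^m` and the odd `h(X⁺)`, i.e. is principal in `Cl(X⁺)`.
[cite: Washington1997, §13.1 and Prop. 13.2] [cite: NeukirchANT1999, Ch. I §8 Prop. (8.2) and §9 (9.1)] -/
theorem dyadic_of_isCMField (hodd : Odd (classNumber ↥(maximalRealSubfield X))) {m : ℕ} (hdeg : Module.finrank ℚ X = 2 ^ m * 2)
    (𝔓 : HeightOneSpectrum (𝓞 X)) (h2 : (2 : 𝓞 X) ∈ 𝔓.asIdeal) (he : 𝔓.asIdeal.ramificationIdx ℤ = 2 ^ (m + 1))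
    (huniq : ∀ Q : HeightOneSpectrum (𝓞 X), (2 : 𝓞 X) ∈ Q.asIdeal → Q = 𝔓) :
    𝔓.asIdeal.ramificationIdx (𝓞 ↥(maximalRealSubfield X)) = 2 ∧
      ClassGroup.mk0 ⟨𝔓.asIdeal, mem_nonZeroDivisors_of_ne_zero 𝔓.ne_bot⟩ ^ 2 = 1 := by
  classical
  haveI : (Ideal.span {(2 : ℤ)}).IsMaximal := ((Ideal.span_singleton_prime two_ne_zero).mpr Int.prime_two).isMaximal (by simp)
  have h20 : Ideal.span {(2 : ℤ)} ≠ ⊥ := by simp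
  set 𝔭 := 𝔓.under (𝓞 ↥(maximalRealSubfield X)) with h𝔭
  haveI := 𝔓.isPrime
  haveI := 𝔭.isPrime
  haveI : 𝔓.asIdeal.LiesOver 𝔭.asIdeal := ⟨rfl⟩
  haveI h𝔓2 : 𝔓.asIdeal.LiesOver (Ideal.span {(2 : ℤ)}) := by
    rw [Ideal.liesOver_span_iff 𝔓.isPrime.ne_top Int.prime_two, map_ofNat]; exact h2
  haveI h𝔭2 : 𝔭.asIdeal.LiesOver (Ideal.span {(2 : ℤ)}) := Ideal.LiesOver.tower_bot 𝔓.asIdeal 𝔭.asIdeal _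
  have h2𝔭 : (2 : 𝓞 ↥(maximalRealSubfield X)) ∈ 𝔭.asIdeal := by
    have h := Ideal.mem_span_singleton_self (2 : ℤ)
    rw [h𝔭2.over, Ideal.under_def, Ideal.mem_comap, map_ofNat] at h
    exact h
  -- degrees
  have hdegp : Module.finrank ℚ ↥(maximalRealSubfield X) = 2 ^ m := by
    have h1 := Module.finrank_mul_finrank ℚ ↥(maximalRealSubfield X) X
    rw [(IsCMField.isQuadraticExtension X).finrank_eq_two, hdeg] at h1
    have : 2 ^ m * 2 = Module.finrank ℚ ↥(maximalRealSubfield X) * 2 := h1.symm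
    omega
  -- (1) `e(𝔓 ∣ 𝔭) = 2` and `e(𝔭 ∣ 2) = 2^m`
  have htower : 𝔓.asIdeal.ramificationIdx ℤ = 𝔭.asIdeal.ramificationIdx ℤ * 𝔓.asIdeal.ramificationIdx (𝓞 ↥(maximalRealSubfield X)) :=
    Ideal.ramificationIdx_tower (R := ℤ) (S := 𝓞 ↥(maximalRealSubfield X)) (T := 𝓞 X) (q := 𝔭.asIdeal) (r := 𝔓.asIdeal)
  have hle2 := ramificationIdx_maximalRealSubfield_le_two X 𝔓
  have hle𝔭 : 𝔭.asIdeal.ramificationIdx ℤ ≤ 2 ^ m := by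
    rw [← hdegp, ← Ideal.ramificationIdx'_eq_ramificationIdx (Ideal.span {(2 : ℤ)}) 𝔭.asIdeal h20]
    exact Ideal.ramificationIdx_le_finrank (𝓞 ↥(maximalRealSubfield X)) ℚ ↥(maximalRealSubfield X) 𝔭.asIdeal
  have hpos𝔓 : 0 < 𝔓.asIdeal.ramificationIdx (𝓞 ↥(maximalRealSubfield X)) := Ideal.ramificationIdx_pos _ _
  have hpos𝔭 : 0 < 𝔭.asIdeal.ramificationIdx ℤ := Ideal.ramificationIdx_pos _ _
  have he𝔓 : 𝔓.asIdeal.ramificationIdx (𝓞 ↥(maximalRealSubfield X)) = 2 := by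
    rw [he, pow_succ] at htower
    rcases Nat.lt_or_ge (𝔓.asIdeal.ramificationIdx (𝓞 ↥(maximalRealSubfield X))) 2 with h | h
    · exfalso
      have h1 : 𝔓.asIdeal.ramificationIdx (𝓞 ↥(maximalRealSubfield X)) = 1 := by omega
      rw [h1, mul_one] at htower
      have : 2 ^ m * 2 ≤ 2 ^ m := htower ▸ hle𝔭
      have : 0 < 2 ^ m := pow_pos two_pos m
      omega
    · omega
  have he𝔭 : 𝔭.asIdeal.ramificationIdx ℤ = 2 ^ m := by
    rw [he, he𝔓, pow_succ] at htower
    exact (Nat.eq_of_mul_eq_mul_right two_pos htower).symm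
  refine ⟨he𝔓, ?_⟩
  -- (2) `𝔭` is the only prime of `X⁺` above `2`
  have huniq𝔭 : ∀ q : HeightOneSpectrum (𝓞 ↥(maximalRealSubfield X)), (2 : 𝓞 ↥(maximalRealSubfield X)) ∈ q.asIdeal → q = 𝔭 := by
    intro q hq
    haveI := q.isMaximal
    obtain ⟨Q, hQmax, hQover⟩ := Ideal.exists_maximal_ideal_liesOver_of_isIntegral (S := 𝓞 X) q.asIdeal
    set QQ : HeightOneSpectrum (𝓞 X) := ⟨Q, hQmax.isPrime, Ideal.ne_bot_of_liesOver_of_ne_bot q.ne_bot Q⟩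
    have h2Q : (2 : 𝓞 X) ∈ QQ.asIdeal := by
      change (2 : 𝓞 X) ∈ Q
      have : algebraMap (𝓞 ↥(maximalRealSubfield X)) (𝓞 X) 2 ∈ Q := by
        rw [← Ideal.mem_comap, ← Ideal.under_def, ← hQover.over]; exact hq
      rwa [map_ofNat] at this
    have hQQ := huniq QQ h2Q
    apply HeightOneSpectrum.ext
    have : q.asIdeal = QQ.asIdeal.under (𝓞 ↥(maximalRealSubfield X)) := hQover.over
    rw [this, hQQ]
    rfl
  -- (3) `𝔭𝓞_X = 𝔓²` and `(2)𝓞_{X⁺} = 𝔭^{2^m}`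
  have hprimes𝔭 : 𝔭.asIdeal.primesOver (𝓞 X) = {𝔓.asIdeal} := by
    ext Q
    simp only [Set.mem_singleton_iff]
    constructor
    · rintro ⟨hQp, hQover⟩
      have hQ0 : Q ≠ ⊥ := Ideal.ne_bot_of_liesOver_of_ne_bot 𝔭.ne_bot Q
      set QQ : HeightOneSpectrum (𝓞 X) := ⟨Q, hQp, hQ0⟩
      have h2Q : (2 : 𝓞 X) ∈ QQ.asIdeal := by
        change (2 : 𝓞 X) ∈ Q
        have : algebraMap (𝓞 ↥(maximalRealSubfield X)) (𝓞 X) 2 ∈ Q := by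
          rw [← Ideal.mem_comap, ← Ideal.under_def, ← hQover.over]; exact h2𝔭
        rwa [map_ofNat] at this
      exact congrArg HeightOneSpectrum.asIdeal (huniq QQ h2Q)
    · rintro rfl
      exact ⟨𝔓.isPrime, ⟨rfl⟩⟩
  haveI := 𝔭.isMaximal
  have hmap𝔭 : 𝔭.asIdeal.map (algebraMap (𝓞 ↥(maximalRealSubfield X)) (𝓞 X)) = 𝔓.asIdeal ^ 2 := by
    rw [Ideal.map_algebraMap_eq_finsetProd_pow (R := 𝓞 X) 𝔭.ne_bot]
    simp only [hprimes𝔭, Set.toFinset_singleton, Finset.prod_singleton, he𝔓]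
  have hprimes2 : (Ideal.span {(2 : ℤ)}).primesOver (𝓞 ↥(maximalRealSubfield X)) = {𝔭.asIdeal} := by
    ext q
    simp only [Set.mem_singleton_iff]
    constructor
    · rintro ⟨hqp, hqover⟩
      have hq0 : q ≠ ⊥ := Ideal.ne_bot_of_liesOver_of_ne_bot h20 q
      set qq : HeightOneSpectrum (𝓞 ↥(maximalRealSubfield X)) := ⟨q, hqp, hq0⟩
      have h2q : (2 : 𝓞 ↥(maximalRealSubfield X)) ∈ qq.asIdeal := by
        have h := Ideal.mem_span_singleton_self (2 : ℤ)
        rw [hqover.over, Ideal.under_def, Ideal.mem_comap, map_ofNat] at h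
        exact h
      exact congrArg HeightOneSpectrum.asIdeal (huniq𝔭 qq h2q)
    · rintro rfl
      exact ⟨𝔭.isPrime, h𝔭2⟩
  have hmap2 : (Ideal.span {(2 : ℤ)}).map (algebraMap ℤ (𝓞 ↥(maximalRealSubfield X))) = 𝔭.asIdeal ^ 2 ^ m := by
    rw [Ideal.map_algebraMap_eq_finsetProd_pow (R := 𝓞 ↥(maximalRealSubfield X)) h20]
    simp only [hprimes2, Set.toFinset_singleton, Finset.prod_singleton, he𝔭]
  -- (4) `[𝔭] = 1` in `Cl(X⁺)`
  have h𝔭cl : ClassGroup.mk0 ⟨𝔭.asIdeal, mem_nonZeroDivisors_of_ne_zero 𝔭.ne_bot⟩ = 1 := by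
    have hpow : ClassGroup.mk0 ⟨𝔭.asIdeal, mem_nonZeroDivisors_of_ne_zero 𝔭.ne_bot⟩ ^ 2 ^ m = 1 := by
      have hmap0 : (Ideal.span {(2 : ℤ)}).map (algebraMap ℤ (𝓞 ↥(maximalRealSubfield X))) ≠ ⊥ := Ideal.map_ne_bot_of_ne_bot h20
      have hprinc : ClassGroup.mk0 ⟨(Ideal.span {(2 : ℤ)}).map (algebraMap ℤ (𝓞 ↥(maximalRealSubfield X))), mem_nonZeroDivisors_of_ne_zero hmap0⟩ = 1 := by
        rw [ClassGroup.mk0_eq_one_iff, Ideal.map_span, Set.image_singleton]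
        exact ⟨⟨algebraMap ℤ (𝓞 ↥(maximalRealSubfield X)) 2, by rw [Ideal.submodule_span_eq]⟩⟩
      rw [← hprinc, ← map_pow]
      congr 1
      apply Subtype.ext
      rw [SubmonoidClass.mk_pow]
      exact hmap2.symm
    have hdvd1 : orderOf (ClassGroup.mk0 (⟨𝔭.asIdeal, mem_nonZeroDivisors_of_ne_zero 𝔭.ne_bot⟩ : (Ideal (𝓞 ↥(maximalRealSubfield X)))⁰)) ∣ 2 ^ m :=
      orderOf_dvd_of_pow_eq_one hpow
    have hdvd2 : orderOf (ClassGroup.mk0 (⟨𝔭.asIdeal, mem_nonZeroDivisors_of_ne_zero 𝔭.ne_bot⟩ : (Ideal (𝓞 ↥(maximalRealSubfield X)))⁰)) ∣ classNumber ↥(maximalRealSubfield X) := by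
      rw [classNumber]; exact orderOf_dvd_card
    have hodd' : Odd (orderOf (ClassGroup.mk0 (⟨𝔭.asIdeal, mem_nonZeroDivisors_of_ne_zero 𝔭.ne_bot⟩ : (Ideal (𝓞 ↥(maximalRealSubfield X)))⁰))) := Odd.of_dvd_nat hodd hdvd2
    obtain ⟨k, -, hk⟩ := (Nat.dvd_prime_pow Nat.prime_two).mp hdvd1
    have hk0 : k = 0 := by
      by_contra hk0
      rw [hk] at hodd'
      exact (Nat.not_even_iff_odd.mpr hodd') (Nat.even_pow.mpr ⟨even_two, hk0⟩)
    rw [hk0, pow_zero] at hk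
    exact orderOf_eq_one_iff.mp hk
  -- (5) `[𝔓]² = i([𝔭]) = 1`
  have hsq : ClassGroup.mk0 ⟨𝔓.asIdeal, mem_nonZeroDivisors_of_ne_zero 𝔓.ne_bot⟩ ^ 2 =
      classGroupExtend ↥(maximalRealSubfield X) X (ClassGroup.mk0 ⟨𝔭.asIdeal, mem_nonZeroDivisors_of_ne_zero 𝔭.ne_bot⟩) := by
    rw [classGroupExtend_mk0, ← map_pow]
    congr 1
    apply Subtype.ext
    rw [SubmonoidClass.mk_pow]
    exact hmap𝔭.symm
  rw [hsq, h𝔭cl, map_one]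

end CM

/-! ## §4 Transport to `X_m = e(K)·ℚ_m ⊆ ℚ̄` -/

section Transport

/-- **Transport of «unique prime above `2` with given ramification index» along a ring isomorphism of number fields.** [folklore]
[cite: NeukirchANT1999, Ch. I §8 Prop. (8.2)] -/
theorem exists_dyadic_prime_of_ringEquiv (X Y : Type) [Field X] [NumberField X] [Field Y] [NumberField Y] (f : X ≃+* Y) {N : ℕ}
    (hY : ∃ (𝔓 : Ideal (𝓞 Y)) (_ : 𝔓.IsMaximal), 𝔓.ramificationIdx ℤ = N ∧ (2 : 𝓞 Y) ∈ 𝔓 ∧ ∀ (Q : Ideal (𝓞 Y)) [Q.IsMaximal], (2 : 𝓞 Y) ∈ Q → Q = 𝔓) :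
    ∃ 𝔓 : HeightOneSpectrum (𝓞 X), (2 : 𝓞 X) ∈ 𝔓.asIdeal ∧ 𝔓.asIdeal.ramificationIdx ℤ = N ∧
      ∀ Q : HeightOneSpectrum (𝓞 X), (2 : 𝓞 X) ∈ Q.asIdeal → Q = 𝔓 := by
  classical
  obtain ⟨𝔓', h𝔓'max, he', h2', huniq'⟩ := hY
  haveI := h𝔓'max
  haveI : (Ideal.span {(2 : ℤ)}).IsMaximal := ((Ideal.span_singleton_prime two_ne_zero).mpr Int.prime_two).isMaximal (by simp)
  have h20 : Ideal.span {(2 : ℤ)} ≠ ⊥ := by simp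
  set fI : 𝓞 X ≃+* 𝓞 Y := RingOfIntegers.mapRingEquiv f with hfI
  let eZ : 𝓞 X ≃ₐ[ℤ] 𝓞 Y := AlgEquiv.ofRingEquiv (f := fI) fun n => by simp
  set P : Ideal (𝓞 X) := 𝔓'.comap eZ with hP
  haveI hPmax : P.IsMaximal := Ideal.comap_isMaximal_of_surjective (eZ : 𝓞 X →+* 𝓞 Y) eZ.surjective
  have hP0 : P ≠ ⊥ := by
    intro h0
    have h𝔓'0 : 𝔓' ≠ ⊥ := Ring.ne_bot_of_isMaximal_of_not_isField h𝔓'max (RingOfIntegers.not_isField Y)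
    apply h𝔓'0
    rw [eq_bot_iff]
    intro y hy
    obtain ⟨x, rfl⟩ := eZ.surjective y
    have : x ∈ P := by rw [hP, Ideal.mem_comap]; exact hy
    rw [h0, Ideal.mem_bot] at this
    rw [this, map_zero]; exact Ideal.zero_mem _
  set 𝔓 : HeightOneSpectrum (𝓞 X) := ⟨P, hPmax.isPrime, hP0⟩
  have h2P : (2 : 𝓞 X) ∈ P := by rw [hP, Ideal.mem_comap, map_ofNat]; exact h2'
  refine ⟨𝔓, h2P, ?_, fun Q hQ => ?_⟩
  · -- ramification index transported
    haveI : P.LiesOver (Ideal.span {(2 : ℤ)}) := by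
      rw [Ideal.liesOver_span_iff hPmax.isPrime.ne_top Int.prime_two, map_ofNat]; exact h2P
    haveI : 𝔓'.LiesOver (Ideal.span {(2 : ℤ)}) := by
      rw [Ideal.liesOver_span_iff h𝔓'max.isPrime.ne_top Int.prime_two, map_ofNat]; exact h2'
    haveI := hPmax.isPrime
    haveI := h𝔓'max.isPrime
    change P.ramificationIdx ℤ = N
    rw [← Ideal.ramificationIdx'_eq_ramificationIdx (Ideal.span {(2 : ℤ)}) P h20, hP, Ideal.ramificationIdx'_comap_eq (Ideal.span {(2 : ℤ)}) eZ 𝔓',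
      Ideal.ramificationIdx'_eq_ramificationIdx (Ideal.span {(2 : ℤ)}) 𝔓' h20, he']
  · -- uniqueness transported
    haveI := Q.isMaximal
    haveI hQ' : (Q.asIdeal.comap (eZ.symm : 𝓞 Y →+* 𝓞 X)).IsMaximal :=
      Ideal.comap_isMaximal_of_surjective (eZ.symm : 𝓞 Y →+* 𝓞 X) eZ.symm.surjective
    have h2Q' : (2 : 𝓞 Y) ∈ Q.asIdeal.comap (eZ.symm : 𝓞 Y →+* 𝓞 X) := by
      rw [Ideal.mem_comap, map_ofNat]; exact hQ
    have hQ𝔓' := huniq' _ h2Q'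
    apply HeightOneSpectrum.ext
    refine (Q.isMaximal.eq_of_le hPmax.ne_top fun x hx => ?_)
    change x ∈ P
    rw [hP, Ideal.mem_comap, ← hQ𝔓', Ideal.mem_comap]
    change eZ.symm (eZ x) ∈ Q.asIdeal
    rw [AlgEquiv.symm_apply_apply]; exact hx

variable {κ : ZpExtension ℚ 2} (hκ : κ.IsCyclotomic) (K : Type) [Field K] [NumberField K]

include hκ in
/-- **The dyadic prime of `X_m = e(K)·ℚ_m`** (`e = absEmbedding ℚ K`, `K ∋ η`, `η² = −d`, `d ≡ 1 (mod 4)`): a unique prime `𝔓_m ∋ 2` of `X_m`, with `e(𝔓_m ∣ 2) = 2^{m+1}`,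
transported from the layer `(K·ℚ_∞)_m` (§2) along the ring isomorphism `X_m ≅ (K·ℚ_∞)_m` of the tree (`exists_ringEquiv_fieldRange_sup_layer_apply`).
[cite: Washington1997, §13.1] [cite: Ferrero1980AJM, §2] -/
theorem exists_dyadic_prime_fieldRange_sup_layer (hK2 : Module.finrank ℚ K = 2) {d : ℕ} (hd4 : d % 4 = 1) (hη : ∃ η : K, η ^ 2 = -((d : ℕ) : K)) (m : ℕ) :
    haveI : NumberField ↥((absEmbedding ℚ K).fieldRange ⊔ κ.layer m) := numberField_fieldRange_sup_layer κ K (absEmbedding ℚ K) m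
    ∃ 𝔓 : HeightOneSpectrum (𝓞 ↥((absEmbedding ℚ K).fieldRange ⊔ κ.layer m)),
      (2 : 𝓞 ↥((absEmbedding ℚ K).fieldRange ⊔ κ.layer m)) ∈ 𝔓.asIdeal ∧ 𝔓.asIdeal.ramificationIdx ℤ = 2 ^ (m + 1) ∧
        ∀ Q : HeightOneSpectrum (𝓞 ↥((absEmbedding ℚ K).fieldRange ⊔ κ.layer m)), (2 : 𝓞 ↥((absEmbedding ℚ K).fieldRange ⊔ κ.layer m)) ∈ Q.asIdeal → Q = 𝔓 := by
  haveI : Fact (Nat.Prime 2) := ⟨Nat.prime_two⟩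
  haveI : NumberField ↥((absEmbedding ℚ K).fieldRange ⊔ κ.layer m) := numberField_fieldRange_sup_layer κ K (absEmbedding ℚ K) m
  have hIQ := isImaginaryQuadratic_of_sq_eq_neg K hK2 (by omega) hη
  have hsurj := surjective_comp_absGaloisRestrict_imaginaryQuadratic_two hκ K hIQ
  have hκ₀c : (κ.restrict K hsurj).IsCyclotomic := isCyclotomic_restrict κ hκ K hsurj
  haveI : FiniteDimensional K ((κ.restrict K hsurj).layer m) := (κ.restrict K hsurj).finiteDimensional_layer_holds m
  haveI : NumberField ((κ.restrict K hsurj).layer m) := NumberField.of_module_finite K _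
  obtain ⟨f, -⟩ := exists_ringEquiv_fieldRange_sup_layer_apply K hsurj m
  obtain ⟨𝔓', h𝔓'max, -, he', h2', huniq'⟩ := exists_dyadic_prime_layer K hK2 hd4 hη (κ.restrict K hsurj) hκ₀c m
  exact exists_dyadic_prime_of_ringEquiv _ _ f ⟨𝔓', h𝔓'max, he', h2', fun Q _ hQ => huniq' Q hQ⟩

end Transport

end Literature.NumberTheory.IwasawaTheory

end
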